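import Literature.NumberTheory.EllipticCurves.ZpExtensionCoeffTwistCoeffActionProofs
import Literature.NumberTheory.GaloisCohomology.Howard2004.DVRKolyvaginBound
import HarnessLib

/-!
# The `Λ`-adic tower `k ↦ M_k ⊗ (Λ/I_k)(χ)` for an antitone family of open ideals `I_•` of `Λ = ℤ_p⟦T⟧`
# (e.g. Howard's SHAPIRO DIAGONAL `I_k = (ω_k, p^k)`, levels `Ind_{K_k/K} E[p^k] = 𝐓/(ω_k, p^k)𝐓`), as an
# instance of `Howard2004.AdicTower K Λ`; its reductions on `H¹` and its `lim_k H¹(K, ·)`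
# (definitions with bodies + rfl/bridge theorems; instances only on the new type synonym `CoeffLevel`)

Topic `NumberTheory/EllipticCurves` (sequel of `ZpExtensionCoeffTwistCores` / `…CoeffActionProofs`; the `R = Λ`
twin of `ZpExtensionEisensteinAdicTower` (x9-p1-w3 g4, `R = S_m = Λ/(q_m)`)). Cell `pub/bsd-print-x9`, seat
`bsd-line-x9-p2` (g3): the Λ-ADIC SOURCE TOWER of STUB 2 of the shared μ-item of crux stmt-BirchSwinnertonDyer-27077
— the carrier on which the lit lineage types the cite-only (F-411) (CGLS22 Thm. 4.1.1: `κ^{Hg} ∈ KS(𝐓, F_Λ, 𝓛_E)`) and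
the SOURCE of the LEAD's `CoeffTowerSetting.Hom.pushforward` (p647970/p648452 + TowerMorphismPushforward) into D1's
`specSetting` (lit g31 16:15:31Z: «source levels N j := Ind_{K_j/K} E[p^j] = 𝐓/(ω_j, p^j)𝐓 … in D1's vocabulary
E[p^j] ⊗ (Λ/(ω_j,p^j))(ψ^{±1})»; x9-p1 LEAD g3 17:06:30Z: «(F-411) typed on the Shapiro-diagonal source»).

Howard [2004, §2.2 = arXiv §3.2, Def. 2.2.3 (p0016 L47–55)]: «`𝐓 = lim← Ind_{K_n/K} T`, the limit with respect to
corestriction … canonical isomorphism `𝐓 ≅ T ⊗ Λ`»; any cofinal family of open ideals presents the same `𝐓`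
(`Howard2004/TowerReindex`). WHAT, for a `ℤ_p`-extension `κ`, an inverse system `(M_k, ρ_k, t_k : M_{k+1} ↠ M_k)`
of discrete Galois modules (for `E`: `M_k = E[p^k]`, `t_k = (P ↦ p P)`), and a family of ideals
`I : ℕ → Ideal Λ` with `I (k+1) ≤ I k`, `ω_{J k} ∈ I k` (so `1 + T` has `p`-power order in `Λ/I k`) and
`𝔪^{e k} ≤ I k` (`I k` open):
* `ZpExtension.CoeffLevel p I M k` — TYPE SYNONYM of the level carrier `M_k ⊗ (Λ/I k)` (`CoeffExtension ℤ (Λ ⧸ I k) (M k)`)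
  with its own instances, among them the `Λ`-module structure through `Λ ↠ Λ/I k` (`Module.compHom`; as for
  `EisensteinLevel`, a dedicated head symbol keeps instance search under the binder `k` deterministic);
* `ZpExtension.coeffLevelRed` — the `Λ`-linear reductions `M_{k+1} ⊗ Λ/I(k+1) → M_k ⊗ Λ/I k`
  (`coeffTwistReduce` along `Ideal.Quotient.factor` and `t k`);
* **`ZpExtension.coeffAdicTower κ ρ t I hI J hJ e he ht : Howard2004.AdicTower K Λ (CoeffLevel p I M)`**
  (`ρ k = coeffTwist`, `hlin` = `Λ`-linearity through `Λ/I k`, `killed k = ⟨e k, _⟩`, `red_surjective` from `ht`);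
* bridges `coeffAdicTower_ρ`, `coeffAdicTower_red_apply`, **`redH1_coeffAdicTower`** (lit's `AdicTower.redH1` IS
  `galoisCohomology.map (coeffTwistReduce …) 1`), **`mem_limitH1_coeffAdicTower_iff`**, and
  **`smulFamily_coeffAdicTower`** (the tower's scalar action of `g ∈ Λ` on families IS `H¹([g] •)` levelwise).
DEFINITIONS WITH BODIES + theorems; no named fact, no instance on existing types, no notation, no `sorry`. Not here:
the Selmer triples `F_Λ` / Kolyvagin-quotient presentations / finite–singular slots making it a `CoeffTowerSetting`
(lit tranche 5), and the comparison with the pin `LambdaAdicSelmerData` (sequel `LambdaAdicSelmerDataToCoeffLimitH1`).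
BSD is not proved by any of this.

References: [Howard2004HeegnerKolyvagin] B. Howard, Compositio Math. 140 (2004), §2.2 Def. 2.2.1–2.2.3 (arXiv:1202.6340
§3.2, p0016 L12–55), §1.6 (arXiv p. 12, L29–55), proof of Thm. 2.2.10; [Washington1997] §7.1, §13.1–§13.2;
[SerreGaloisCohomology1997] I §2.2, §2.5; [PerrinRiou1987BSMF] §0 p. 402.
-/

noncomputable section

open scoped TensorProduct ContRepresentation
open Field IsLocalRing

namespace Literature.NumberTheory.EllipticCurves.ZpExtension

open Literature.NumberTheory.GaloisRepresentations
open Literature.NumberTheory.GaloisCohomology.Howard2004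

/-! ## §1 The level carriers `M_k ⊗ (Λ/I_k)` as `Λ`-modules -/

section Level

variable {p : ℕ} [hp : Fact p.Prime] {M : ℕ → Type} [∀ k, AddCommGroup (M k)]

/-- **The carrier `M ⊗ A` with the `ℤ`-algebra structure of `A` PINNED to the generic `Ring.toIntAlgebra`** (the
structure the generic constructions `coeffTwist` / `coeffUnit` / `coresCoeff` / `coeffTwistReduce` of
`ZpExtensionCoeffTwistCores` carry for a variable ring `A`; at a concrete quotient `A = Λ ⧸ I` instance resolution would
otherwise produce `Ideal.instAlgebraQuotient`, propositionally but not definitionally equal — same device as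
`IwasawaAlgebra.EisensteinCoeff.Twisted`). Use this spelling at quotient rings. [cite: Howard2004HeegnerKolyvagin, §2.2 (𝐓/I𝐓)] -/
abbrev QuotTwisted (A : Type) [CommRing A] (M : Type) [AddCommGroup M] : Type :=
  @CoeffExtension ℤ _ A _ (Ring.toIntAlgebra _) M _ _

/-- The pure tensor `c ⊗ a` in the pinned carrier. [cite: Howard2004HeegnerKolyvagin, §2.2 (𝐓/I𝐓)] -/
abbrev QuotTwisted.tmul {A : Type} [CommRing A] {M : Type} [AddCommGroup M] (c : A) (a : M) : QuotTwisted A M :=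
  @CoeffExtension.tmul ℤ _ A _ (Ring.toIntAlgebra _) M _ _ c a

variable (p) in
/-- **The level-`k` carrier `M_k ⊗ (Λ/I_k)`** of the `Λ`-adic tower, as a TYPE SYNONYM (a `def`) of the pinned carrier
`QuotTwisted (Λ ⧸ I k) (M k)` carrying its own copies of the instances (for synthesis under the binder `k`).
[cite: Howard2004HeegnerKolyvagin, §2.2 Def. 2.2.3 (𝐓 = lim← Ind_{K_n/K} T)] -/
def CoeffLevel (I : ℕ → Ideal (IwasawaAlgebra p)) (M : ℕ → Type) [∀ k, AddCommGroup (M k)] (k : ℕ) : Type :=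
  QuotTwisted (IwasawaAlgebra p ⧸ I k) (M k)

namespace CoeffLevel

variable (p) (I : ℕ → Ideal (IwasawaAlgebra p)) (M)

/-- `M_k ⊗ Λ/I_k` is an abelian group (the instance of `CoeffExtension`). [cite: Howard2004HeegnerKolyvagin, §2.2] -/
instance instAddCommGroup (k : ℕ) : AddCommGroup (CoeffLevel p I M k) :=
  inferInstanceAs (AddCommGroup (QuotTwisted (IwasawaAlgebra p ⧸ I k) (M k)))

/-- `M_k ⊗ Λ/I_k` is a `Λ/I_k`-module (the instance of `CoeffExtension`). [cite: Howard2004HeegnerKolyvagin, §2.2] -/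
instance instModule (k : ℕ) : Module (IwasawaAlgebra p ⧸ I k) (CoeffLevel p I M k) :=
  inferInstanceAs (Module (IwasawaAlgebra p ⧸ I k) (QuotTwisted (IwasawaAlgebra p ⧸ I k) (M k)))

/-- The discrete topology on `M_k ⊗ Λ/I_k` (the instance of `CoeffExtension`). [cite: SerreGaloisCohomology1997, I §2.1] -/
instance instTopologicalSpace (k : ℕ) : TopologicalSpace (CoeffLevel p I M k) :=
  inferInstanceAs (TopologicalSpace (QuotTwisted (IwasawaAlgebra p ⧸ I k) (M k)))

/-- `M_k ⊗ Λ/I_k` is discrete. [cite: SerreGaloisCohomology1997, I §2.1] -/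
instance instDiscreteTopology (k : ℕ) : DiscreteTopology (CoeffLevel p I M k) :=
  inferInstanceAs (DiscreteTopology (QuotTwisted (IwasawaAlgebra p ⧸ I k) (M k)))

/-- `M_k ⊗ Λ/I_k` as a `Λ`-module through `Λ ↠ Λ/I_k` (Mathlib `Module.compHom`; instance on the synonym only):
`f • x = [f] • x`. [cite: Howard2004HeegnerKolyvagin, §2.2 (𝐓 = T ⊗ Λ as a Λ-module)] -/
instance instModuleIwasawa (k : ℕ) : Module (IwasawaAlgebra p) (CoeffLevel p I M k) :=
  Module.compHom (CoeffLevel p I M k) (Ideal.Quotient.mk (I k) : IwasawaAlgebra p →+* IwasawaAlgebra p ⧸ I k)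

variable {p I M}

/-- Unfolding the `Λ`-action: `f • x = [f]_{Λ/I_k} • x`. [cite: Howard2004HeegnerKolyvagin, §2.2] -/
theorem iwasawa_smul_def (k : ℕ) (f : IwasawaAlgebra p) (x : CoeffLevel p I M k) :
    f • x = (Ideal.Quotient.mk (I k) f) • x := rfl

/-- Elements of `I_k` act by zero on level `k`. [cite: Howard2004HeegnerKolyvagin, §2.2] -/
theorem smul_eq_zero_of_mem (k : ℕ) {f : IwasawaAlgebra p} (hf : f ∈ I k) (x : CoeffLevel p I M k) : f • x = 0 := by
  rw [iwasawa_smul_def, Ideal.Quotient.eq_zero_iff_mem.mpr hf]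
  exact zero_smul (IwasawaAlgebra p ⧸ I k) x

/-- The identity `CoeffLevel p I M k = QuotTwisted (Λ ⧸ I k) (M k)` as an additive isomorphism.
[cite: Howard2004HeegnerKolyvagin, §2.2] -/
def equivQuotTwisted (k : ℕ) : CoeffLevel p I M k ≃+ QuotTwisted (IwasawaAlgebra p ⧸ I k) (M k) :=
  AddEquiv.refl _

/-- `equivQuotTwisted` is the identity map. [cite: Howard2004HeegnerKolyvagin, §2.2] -/
@[simp] theorem equivQuotTwisted_apply (k : ℕ) (x : CoeffLevel p I M k) :
    equivQuotTwisted k x = (x : QuotTwisted (IwasawaAlgebra p ⧸ I k) (M k)) := rfl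

end CoeffLevel

end Level

/-! ## §2 The tower -/

section Tower

variable {K : Type} [Field K] {p : ℕ} [hp : Fact p.Prime] (κ : ZpExtension K p)
  {M : ℕ → Type} [∀ k, AddCommGroup (M k)] [∀ k, TopologicalSpace (M k)] [∀ k, DiscreteTopology (M k)]
  (ρ : ∀ k, DiscreteGaloisModule K (M k))
  (t : ∀ k, (ρ (k + 1)).toContRepresentation →ⁱL (ρ k).toContRepresentation)
  (I : ℕ → Ideal (IwasawaAlgebra p)) (hI : ∀ k, I (k + 1) ≤ I k)
  (J : ℕ → ℕ) (hJ : ∀ k, ((1 + PowerSeries.X : IwasawaAlgebra p) ^ (p ^ J k) - 1) ∈ I k)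

/-- The twisting unit `u_k = [1 + T] ∈ Λ/I_k`. [cite: Howard2004HeegnerKolyvagin, §2.2 (γ ↦ 1 + T)] -/
abbrev coeffLevelUnit (k : ℕ) : IwasawaAlgebra p ⧸ I k := Ideal.Quotient.mk (I k) (1 + PowerSeries.X)

/-- `Ideal.Quotient.factor` carries `[1 + T]_{Λ/I(k+1)}` to `[1 + T]_{Λ/I k}`. [cite: Washington1997, §13.1] -/
theorem factor_coeffLevelUnit (k : ℕ) :
    Ideal.Quotient.factor (hI k) (coeffLevelUnit I (k + 1)) = coeffLevelUnit I k :=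
  Ideal.Quotient.factor_mk _ _

/-- **The reduction `M_{k+1} ⊗ (Λ/I(k+1))(χ) → M_k ⊗ (Λ/I k)(χ)` as a morphism of the twisted discrete Galois modules**:
`coeffTwistReduce` along the ring change `Λ/I(k+1) ↠ Λ/I k` and `t k : M_{k+1} → M_k`.
[cite: Howard2004HeegnerKolyvagin, §2.2 Def. 2.2.3 (limit along corestriction / reduction)] -/
def coeffLevelReduce (k : ℕ) :
    (κ.coeffTwist (ρ (k + 1)) (coeffLevelUnit I (k + 1)) (J (k + 1))
        (mk_one_add_X_pow_prime_pow_eq_one (I (k + 1)) (hJ (k + 1)))).toContRepresentation →ⁱL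
      (κ.coeffTwist (ρ k) (coeffLevelUnit I k) (J k) (mk_one_add_X_pow_prime_pow_eq_one (I k) (hJ k))).toContRepresentation :=
  κ.coeffTwistReduce (mk_one_add_X_pow_prime_pow_eq_one (I (k + 1)) (hJ (k + 1)))
    (mk_one_add_X_pow_prime_pow_eq_one (I k) (hJ k)) (Ideal.Quotient.factor (hI k)) (factor_coeffLevelUnit I hI k) (t k)

/-- `coeffLevelReduce` on pure tensors: `c ⊗ a ↦ (c mod I k) ⊗ t k a`. [cite: Howard2004HeegnerKolyvagin, §2.2] -/
theorem coeffLevelReduce_tmul (k : ℕ) (c : IwasawaAlgebra p ⧸ I (k + 1)) (a : M (k + 1)) :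
    κ.coeffLevelReduce ρ t I hI J hJ k (QuotTwisted.tmul c a) =
      QuotTwisted.tmul (Ideal.Quotient.factor (hI k) c) (t k a) :=
  κ.coeffTwistReduce_tmul _ _ _ _ (t k) c a

/-- **The `Λ`-linear reduction `M_{k+1} ⊗ Λ/I(k+1) → M_k ⊗ Λ/I k`** of the tower (`coeffLevelReduce` on the synonym
`CoeffLevel`; `Λ`-linear because the reduction is semilinear along a map under `Λ`).
[cite: Howard2004HeegnerKolyvagin, §2.2 Def. 2.2.3] -/
def coeffLevelRed (k : ℕ) : CoeffLevel p I M (k + 1) →ₗ[IwasawaAlgebra p] CoeffLevel p I M k where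
  toFun x := κ.coeffLevelReduce ρ t I hI J hJ k (x : QuotTwisted (IwasawaAlgebra p ⧸ I (k + 1)) (M (k + 1)))
  map_add' x y := map_add _ _ _
  map_smul' f x := by
    change κ.coeffLevelReduce ρ t I hI J hJ k
        ((Ideal.Quotient.mk (I (k + 1)) f) • (x : QuotTwisted (IwasawaAlgebra p ⧸ I (k + 1)) (M (k + 1)))) =
      (Ideal.Quotient.mk (I k) f) • κ.coeffLevelReduce ρ t I hI J hJ k _
    have h := κ.coeffTwistReduce_smul (mk_one_add_X_pow_prime_pow_eq_one (I (k + 1)) (hJ (k + 1)))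
      (mk_one_add_X_pow_prime_pow_eq_one (I k) (hJ k)) (Ideal.Quotient.factor (hI k)) (factor_coeffLevelUnit I hI k) (t k)
      (Ideal.Quotient.mk (I (k + 1)) f) (x : QuotTwisted (IwasawaAlgebra p ⧸ I (k + 1)) (M (k + 1)))
    rw [Ideal.Quotient.factor_mk] at h
    exact h

/-- Unfolding `coeffLevelRed`: it is `coeffLevelReduce` on the underlying carriers. [cite: Howard2004HeegnerKolyvagin, §2.2] -/
theorem coeffLevelRed_apply (k : ℕ) (x : CoeffLevel p I M (k + 1)) :
    κ.coeffLevelRed ρ t I hI J hJ k x =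
      κ.coeffLevelReduce ρ t I hI J hJ k (x : QuotTwisted (IwasawaAlgebra p ⧸ I (k + 1)) (M (k + 1))) :=
  rfl

variable (e : ℕ → ℕ) (he : ∀ k, maximalIdeal (IwasawaAlgebra p) ^ e k ≤ I k)

omit [∀ k, TopologicalSpace (M k)] [∀ k, DiscreteTopology (M k)] in
include he in
/-- **`𝔪^{e k}` kills level `k`** (`I k` is open: `𝔪^{e k} ≤ I k`, and `I k` acts by zero through `Λ/I k`).
[cite: Howard2004HeegnerKolyvagin, §1.6 (arXiv p. 12: the levels T/𝔪^k T)] -/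
theorem maximalIdeal_pow_smul_coeffLevel (k : ℕ) (r : IwasawaAlgebra p) (hr : r ∈ maximalIdeal (IwasawaAlgebra p) ^ e k)
    (x : CoeffLevel p I M k) : r • x = 0 :=
  CoeffLevel.smul_eq_zero_of_mem k (he k hr) x

/-- **The `Λ`-adic tower `k ↦ M_k ⊗ (Λ/I_k)(χ)`** as a term of lit's `Howard2004.AdicTower K Λ (CoeffLevel p I M)`: levels
the twists `κ.coeffTwist (ρ k) u_k (J k) _` (`u_k = [1+T]`), `Λ`-linear through `Λ/I k`, killed by `𝔪^{e k}`, with the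
surjective `Λ`-linear equivariant reductions `coeffLevelRed` (surjectivity from that of `t k` and of `Λ/I(k+1) ↠ Λ/I k`).
For `M_k = E[p^k]`, `t_k = (p ·)`, `I_k = (ω_k, p^k)` this is Howard's `𝐓 = lim← Ind_{K_k/K} E[p^k]` (the SHAPIRO
DIAGONAL); any cofinal family `I_•` presents the same `𝐓`. [cite: Howard2004HeegnerKolyvagin, §2.2 Def. 2.2.3 (arXiv p0016 L47–55) and §1.6 (arXiv p. 12, L29–55)] -/
def coeffAdicTower (ht : ∀ k, Function.Surjective (t k)) :
    AdicTower K (IwasawaAlgebra p) (CoeffLevel p I M) :=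
  { ρ := fun k ↦ (κ.coeffTwist (ρ k) (coeffLevelUnit I k) (J k) (mk_one_add_X_pow_prime_pow_eq_one (I k) (hJ k)) :
      ContinuousRep (absoluteGaloisGroup K) ℤ (CoeffLevel p I M k))
    hlin := fun k σ f x ↦ by
      rw [CoeffLevel.iwasawa_smul_def, CoeffLevel.iwasawa_smul_def]
      exact κ.coeffTwist_apply_smul (ρ k) (mk_one_add_X_pow_prime_pow_eq_one (I k) (hJ k)) σ _ _
    killed := fun k ↦ ⟨e k, fun r hr x ↦ maximalIdeal_pow_smul_coeffLevel I e he k r hr x⟩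
    red := κ.coeffLevelRed ρ t I hI J hJ
    red_surjective := fun k ↦
      κ.coeffTwistReduce_surjective (mk_one_add_X_pow_prime_pow_eq_one (I (k + 1)) (hJ (k + 1)))
        (mk_one_add_X_pow_prime_pow_eq_one (I k) (hJ k)) (Ideal.Quotient.factor (hI k)) (factor_coeffLevelUnit I hI k)
        (t k) (Ideal.Quotient.factor_surjective (hI k)) (ht k)
    red_equivariant := fun k σ x ↦
      congrArg (fun φ ↦ φ x) ((κ.coeffLevelReduce ρ t I hI J hJ k).isIntertwining' σ) }

/-- The levels of the tower are the twists `κ.coeffTwist (ρ k) [1+T] (J k) _`. [cite: Howard2004HeegnerKolyvagin, §2.2] -/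
theorem coeffAdicTower_ρ (ht : ∀ k, Function.Surjective (t k)) (k : ℕ) :
    (κ.coeffAdicTower ρ t I hI J hJ e he ht).ρ k =
      (κ.coeffTwist (ρ k) (coeffLevelUnit I k) (J k) (mk_one_add_X_pow_prime_pow_eq_one (I k) (hJ k)) :
        ContinuousRep (absoluteGaloisGroup K) ℤ (CoeffLevel p I M k)) :=
  rfl

/-- The reductions of the tower are `coeffTwistReduce` along `Λ/I(k+1) ↠ Λ/I k` and `t k`. [cite: Howard2004HeegnerKolyvagin, §2.2] -/
theorem coeffAdicTower_red_apply (ht : ∀ k, Function.Surjective (t k)) (k : ℕ) (x : CoeffLevel p I M (k + 1)) :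
    (κ.coeffAdicTower ρ t I hI J hJ e he ht).red k x =
      κ.coeffLevelReduce ρ t I hI J hJ k (x : QuotTwisted (IwasawaAlgebra p ⧸ I (k + 1)) (M (k + 1))) :=
  rfl

/-! ## §3 `H¹` of the reductions, the limit, and the scalar action on families -/

/-- **`H¹(red)` in lit's spelling is `H¹(coeffTwistReduce)` in this lineage's spelling**: `AdicTower.redH1` of the tower
(`ContinuousRep.cohomologyMap` of the reduction) is `galoisCohomology.map (κ.coeffTwistReduce …) 1`.
[cite: Howard2004HeegnerKolyvagin, §1.6 (arXiv p. 12, L29–55)] [cite: SerreGaloisCohomology1997, I §2.2] -/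
theorem redH1_coeffAdicTower (ht : ∀ k, Function.Surjective (t k)) (k : ℕ) :
    (κ.coeffAdicTower ρ t I hI J hJ e he ht).redH1 k =
      galoisCohomology.map (κ.coeffLevelReduce ρ t I hI J hJ k) 1 := by
  refine AddMonoidHom.ext fun x ↦ ?_
  obtain ⟨φ, rfl⟩ := oneCocycleClass_surjective
    (DiscreteGaloisModule.toTopRep ((κ.coeffAdicTower ρ t I hI J hJ e he ht).ρ (k + 1))) x
  change ContinuousCohomology.map _ _ 1 _ = ContinuousCohomology.map _ _ 1 _
  erw [map_oneCocycleClass]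

/-- **Membership in `lim_k H¹(K, M_k ⊗ Λ/I_k)`** of the tower is compatibility under
`galoisCohomology.map (coeffTwistReduce …) 1`. [cite: Howard2004HeegnerKolyvagin, §1.6 (arXiv p. 12, L29–55) and §2.2 Def. 2.2.3] -/
theorem mem_limitH1_coeffAdicTower_iff (ht : ∀ k, Function.Surjective (t k)) :
    ∀ x : ∀ k, galoisCohomology ((κ.coeffAdicTower ρ t I hI J hJ e he ht).ρ k) 1,
      x ∈ (κ.coeffAdicTower ρ t I hI J hJ e he ht).limitH1 ↔
        ∀ k, galoisCohomology.map (κ.coeffLevelReduce ρ t I hI J hJ k) 1 (x (k + 1)) = x k := by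
  intro x
  change (∀ k, (κ.coeffAdicTower ρ t I hI J hJ e he ht).redH1 k (x (k + 1)) = x k) ↔ _
  simp only [redH1_coeffAdicTower]
  exact Iff.rfl

/-- **The tower's scalar action on families is `H¹([g] •)` levelwise**: for `g ∈ Λ`,
`smulFamily g x k = galoisCohomology.map (coeffTwistSMulHom … [g]_{Λ/I k}) 1 (x k)` (definitional: the `Λ`-action on
the level is `[g] •`). [cite: Howard2004HeegnerKolyvagin, §2.2 Def. 2.2.3 (H¹(K, 𝐓) as a Λ-module)] -/
theorem smulFamily_coeffAdicTower (ht : ∀ k, Function.Surjective (t k)) (g : IwasawaAlgebra p)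
    (x : ∀ k, galoisCohomology ((κ.coeffAdicTower ρ t I hI J hJ e he ht).ρ k) 1) (k : ℕ) :
    (κ.coeffAdicTower ρ t I hI J hJ e he ht).smulFamily g x k =
      galoisCohomology.map (κ.coeffTwistSMulHom (ρ k) (mk_one_add_X_pow_prime_pow_eq_one (I k) (hJ k))
        (Ideal.Quotient.mk (I k) g)) 1 (x k) :=
  rfl

end Tower

/-! ## §4 Howard's Shapiro diagonal `I_k = (ω_k, p^k)` -/

section Shapiro

variable (p : ℕ) [hp : Fact p.Prime]

/-- **The Shapiro-diagonal ideals `I_k = (ω_k, p^k)`**, `ω_k = (1+T)^{p^k} − 1`: `Λ/I_k = ℤ/p^k[Gal(K_k/K)]`, so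
`E[p^k] ⊗ (Λ/I_k)(ψ) = Ind_{K_k/K} E[p^k]` and `H¹(K, ·) = H¹(K_k, E[p^k])` (Shapiro) — Howard's own presentation
`𝐓 = lim← Ind_{K_n/K} T`. [cite: Howard2004HeegnerKolyvagin, §2.2 Def. 2.2.1–2.2.3 (arXiv p0016 L12–55)] [cite: Washington1997, §13.2 (Λ/ω_n = ℤ_p[Γ/Γ_n])] -/
def shapiroIdeal (k : ℕ) : Ideal (IwasawaAlgebra p) :=
  Ideal.span {((1 + PowerSeries.X : IwasawaAlgebra p) ^ (p ^ k) - 1)} ⊔ Ideal.span {((p : IwasawaAlgebra p) ^ k)}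

/-- `ω_k ∈ I_k`. [cite: Washington1997, §13.2] -/
theorem omega_mem_shapiroIdeal (k : ℕ) :
    ((1 + PowerSeries.X : IwasawaAlgebra p) ^ (p ^ k) - 1) ∈ shapiroIdeal p k :=
  Ideal.mem_sup_left (Ideal.mem_span_singleton_self _)

/-- `p^k ∈ I_k`. [cite: Washington1997, §13.2] -/
theorem natCast_pow_mem_shapiroIdeal (k : ℕ) : ((p : IwasawaAlgebra p) ^ k) ∈ shapiroIdeal p k :=
  Ideal.mem_sup_right (Ideal.mem_span_singleton_self _)

/-- `ω_k ∣ ω_{k+1}`: `(1+T)^{p^{k+1}} − 1 = ((1+T)^{p^k})^p − 1`. [cite: Washington1997, §13.2 (Lemma 13.7)] -/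
theorem omega_dvd_omega_succ (k : ℕ) :
    ((1 + PowerSeries.X : IwasawaAlgebra p) ^ (p ^ k) - 1) ∣ ((1 + PowerSeries.X : IwasawaAlgebra p) ^ (p ^ (k + 1)) - 1) := by
  rw [pow_succ, pow_mul]
  exact sub_one_dvd_pow_sub_one _ _

/-- **The Shapiro diagonal is antitone**: `I_{k+1} ≤ I_k`. [cite: Howard2004HeegnerKolyvagin, §2.2 Def. 2.2.3 (the transition maps)] -/
theorem shapiroIdeal_succ_le (k : ℕ) : shapiroIdeal p (k + 1) ≤ shapiroIdeal p k := by
  refine sup_le ((Ideal.span_singleton_le_iff_mem _).mpr ?_) ((Ideal.span_singleton_le_iff_mem _).mpr ?_)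
  · exact Ideal.mem_sup_left (Ideal.mem_span_singleton.mpr (omega_dvd_omega_succ p k))
  · exact Ideal.mem_sup_right (Ideal.mem_span_singleton.mpr (pow_dvd_pow _ (Nat.le_succ k)))

/-- `T^{p^k} ∈ (ω_k, p)`: `(1+T)^{p^k} ≡ 1 + T^{p^k} (mod p)` (Frobenius). [cite: Washington1997, §7.1] -/
theorem X_pow_prime_pow_mem_span_omega_sup_span_natCast (k : ℕ) :
    (PowerSeries.X : IwasawaAlgebra p) ^ (p ^ k) ∈
      Ideal.span {((1 + PowerSeries.X : IwasawaAlgebra p) ^ (p ^ k) - 1)} ⊔ Ideal.span {(p : IwasawaAlgebra p)} := by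
  obtain ⟨r, hr⟩ := exists_add_pow_prime_pow_eq hp.out (1 : IwasawaAlgebra p) PowerSeries.X k
  -- `(1+X)^{p^k} = 1 + X^{p^k} + p * 1 * X * r`
  have h : (PowerSeries.X : IwasawaAlgebra p) ^ (p ^ k) =
      ((1 + PowerSeries.X) ^ (p ^ k) - 1) + (p : IwasawaAlgebra p) * (-(PowerSeries.X * r)) := by
    rw [hr, one_pow]; ring
  rw [h]
  exact Ideal.add_mem _ (Ideal.mem_sup_left (Ideal.mem_span_singleton_self _))
    (Ideal.mem_sup_right (Ideal.mul_mem_right _ _ (Ideal.mem_span_singleton_self _)))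

/-- **`T^{k p^k} ∈ I_k`**: `T^{p^k} = ω + p s` with `ω ∈ (ω_k)`, so `T^{k p^k} = (ω + p s)^k ∈ (ω_k) + (p^k)`.
[cite: Washington1997, §7.1 and §13.2] -/
theorem X_pow_mem_shapiroIdeal (k : ℕ) : (PowerSeries.X : IwasawaAlgebra p) ^ (k * p ^ k) ∈ shapiroIdeal p k := by
  obtain ⟨a, ha, b, hb, hab⟩ := Submodule.mem_sup.mp (X_pow_prime_pow_mem_span_omega_sup_span_natCast p k)
  obtain ⟨s, rfl⟩ := Ideal.mem_span_singleton'.mp hb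
  rw [mul_comm k, pow_mul, ← hab, add_pow]
  refine Ideal.sum_mem _ fun i _ ↦ ?_
  rcases Nat.eq_zero_or_pos i with rfl | hi0
  · rw [pow_zero, one_mul, Nat.sub_zero, Nat.choose_zero_right, Nat.cast_one, mul_one, mul_pow]
    exact Ideal.mem_sup_right (Ideal.mul_mem_left _ _ (Ideal.mem_span_singleton_self _))
  · exact Ideal.mem_sup_left
      (Ideal.mul_mem_right _ _ (Ideal.mul_mem_right _ _ (Ideal.pow_mem_of_mem _ ha i hi0)))

/-- `𝔪_Λ ⊆ (T) + (p)`: a non-unit power series has constant term in `p ℤ_p`, and `f = C(f₀) + T·g`.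
[cite: Washington1997, §7.1 (𝔪 = (p, T))] -/
theorem maximalIdeal_le_span_X_sup_span_natCast :
    maximalIdeal (IwasawaAlgebra p) ≤
      Ideal.span {(PowerSeries.X : IwasawaAlgebra p)} ⊔ Ideal.span {(p : IwasawaAlgebra p)} := by
  intro f hf
  have hf0 : PowerSeries.constantCoeff f ∈ maximalIdeal ℤ_[p] := by
    rw [mem_maximalIdeal, mem_nonunits_iff] at hf ⊢
    exact fun hu ↦ hf (PowerSeries.isUnit_iff_constantCoeff.mpr hu)
  rw [PadicInt.maximalIdeal_eq_span_p, Ideal.mem_span_singleton] at hf0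
  obtain ⟨c, hc⟩ := hf0
  have hshift := PowerSeries.sub_const_eq_X_mul_shift f
  have hf' : f = PowerSeries.X * (PowerSeries.mk fun n ↦ PowerSeries.coeff (n + 1) f) +
      (p : IwasawaAlgebra p) * PowerSeries.C c := by
    rw [← map_natCast (PowerSeries.C (R := ℤ_[p])) p, ← map_mul, ← hc]
    linear_combination hshift
  rw [hf']
  exact Ideal.add_mem _ (Ideal.mem_sup_left (Ideal.mul_mem_right _ _ (Ideal.mem_span_singleton_self _)))
    (Ideal.mem_sup_right (Ideal.mul_mem_right _ _ (Ideal.mem_span_singleton_self _)))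

/-- **`𝔪^{k p^k + k} ≤ I_k`** (`𝔪 = (p, T)` the maximal ideal of `Λ`): the Shapiro-diagonal levels are killed by a
power of `𝔪` — the `killed` field of `Howard2004.AdicTower` (`(𝔞 ⊔ 𝔟)^{m+n} ≤ 𝔞^m ⊔ 𝔟^n`).
[cite: Washington1997, §7.1 (𝔪 = (p,T)) and §13.2] -/
theorem maximalIdeal_pow_le_shapiroIdeal (k : ℕ) :
    maximalIdeal (IwasawaAlgebra p) ^ (k * p ^ k + k) ≤ shapiroIdeal p k := by
  refine (Ideal.pow_right_mono (maximalIdeal_le_span_X_sup_span_natCast p) _).trans ?_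
  refine Ideal.sup_pow_add_le_pow_sup_pow.trans ?_
  rw [Ideal.span_singleton_pow, Ideal.span_singleton_pow]
  exact sup_le ((Ideal.span_singleton_le_iff_mem _).mpr (X_pow_mem_shapiroIdeal p k))
    ((Ideal.span_singleton_le_iff_mem _).mpr (natCast_pow_mem_shapiroIdeal p k))

end Shapiro

end Literature.NumberTheory.EllipticCurves.ZpExtension

end
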